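import Summits.Ventures.HodgeRepro.FaceCensusRows8
import Summits.Ventures.HodgeRepro.EngineBridge
import Summits.Ventures.HodgeRepro.Night1Faces8Quaternion

/-!
# The sealed link for the row `Octic.Quaternion`: each `FaceData` of the table IS the sealed representative

Blind re-derivation cell `pub-hodge-repro`, seat `night-1` (GENERATED by `bin/gen_sealed_link.py`).  For each sealed
representative `(Φ, π, π′)` of `Octic.Quaternion.reps` (the `n`-th entry, `face<n>_rep`), the engine's corners
`Γ.corners` are the four masks recorded (`face<n>_corners`), and the model face `(face<n>).face` of
`Night1Faces8Quaternion.lean` is the image of those masks' finsets (p2's `EngineBridge.finsetOf`) under the sealed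
dictionary `enum` (`face<n>_sealed`) — all by `decide`.  So the table's faces are the sealed census's faces, read
through the sealed dictionary; nothing here says anything about the status of the Hodge conjecture for CM abelian
varieties, which is NOT proved.
-/

open Finset
open scoped Pointwise

namespace HodgeRepro.RouteC

namespace Faces8Quaternion

open Summit.Ventures.HodgeRepro.FaceCensus

/-- The sealed dictionary `enum` of the row, into typer's group `Q8`. -/
def sealedEnum : Fin 8 → Q8 := Octic.Quaternion.enum

/-- Face 0 is the sealed representative number 0. -/
theorem face0_rep : Octic.Quaternion.reps.getD 0 (0, 0, 0) = (51, 5, 10) := by decide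

/-- The engine's corners of the sealed representative 0. -/
theorem face0_corners : Octic.Quaternion.Γ.corners (51, 5, 10) = [51, 201, 198, 60] := by decide

/-- **The model face 0 is the sealed face 0**: corner by corner, the image of the engine's mask under `enum`. -/
theorem face0_sealed : ∀ i : Fin 4, (face0).face cc_Q8 i =
    (EngineBridge.finsetOf Octic.Quaternion.Γ ((Octic.Quaternion.Γ.corners (51, 5, 10)).getD i.val 0)).image
      (fun e => sealedEnum (EngineBridge.Elt.idx Octic.Quaternion.Γ e)) := by decide

/-- Face 1 is the sealed representative number 1. -/
theorem face1_rep : Octic.Quaternion.reps.getD 1 (0, 0, 0) = (51, 5, 80) := by decide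

/-- The engine's corners of the sealed representative 1. -/
theorem face1_corners : Octic.Quaternion.Γ.corners (51, 5, 80) = [51, 201, 156, 102] := by decide

/-- **The model face 1 is the sealed face 1**: corner by corner, the image of the engine's mask under `enum`. -/
theorem face1_sealed : ∀ i : Fin 4, (face1).face cc_Q8 i =
    (EngineBridge.finsetOf Octic.Quaternion.Γ ((Octic.Quaternion.Γ.corners (51, 5, 80)).getD i.val 0)).image
      (fun e => sealedEnum (EngineBridge.Elt.idx Octic.Quaternion.Γ e)) := by decide

/-- Face 2 is the sealed representative number 2. -/
theorem face2_rep : Octic.Quaternion.reps.getD 2 (0, 0, 0) = (51, 5, 160) := by decide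

/-- The engine's corners of the sealed representative 2. -/
theorem face2_corners : Octic.Quaternion.Γ.corners (51, 5, 160) = [51, 201, 108, 150] := by decide

/-- **The model face 2 is the sealed face 2**: corner by corner, the image of the engine's mask under `enum`. -/
theorem face2_sealed : ∀ i : Fin 4, (face2).face cc_Q8 i =
    (EngineBridge.finsetOf Octic.Quaternion.Γ ((Octic.Quaternion.Γ.corners (51, 5, 160)).getD i.val 0)).image
      (fun e => sealedEnum (EngineBridge.Elt.idx Octic.Quaternion.Γ e)) := by decide

end Faces8Quaternion

end HodgeRepro.RouteC
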